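import Literature.Combinatorics.Sahi2008.Functional
import Mathlib.Tactic.Linarith
import Mathlib.Tactic.Ring
import Mathlib.Tactic.GCongr
import HarnessLib

/-!
# `NoHeavyLowerTail` (crux stmt-CriticalPhenomena-4575), P2 — chain triangle, part 1/4: clone lemmas, the `S`-pattern integral, the pointwise 2×2×2 inequality

Memo SAHI-ROUTE.md §4.17 (seat `prim-masterthm-p2`, gen 5; `--supports stmt-CriticalPhenomena-4575`).  No `sorry`, no named facts, standard axioms.

THE THEOREM (file `…SahiChainTriangle`): for probability weights `wA, wB, wC` on three finite LINEAR orders `α, β, γ` and nonnegative coordinatewise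
increasing `f : γ → α → ℝ`, `g : γ → β → ℝ`, `h : α → β → ℝ` (a "triangle": each function sees two of three independent chains), under the product weight
on `α × β × γ`:  `2·E_3(f,g,h) ≥ P_A + P_B + P_C ≥ 0`, `P_C = Σ_{a,b} wA wB h·Cov_c(f(·,a),g(·,b))` etc.; in particular Sahi's `C_3` holds for this class
(Lieb–Sahi [LiebSahi2021, Thm 3.7] is the square — two chains; three chains are open in general).  PROOF: two independent clones per chain,
`8P_X = E[S_X]`, `8(ΣP − E_3) = E[Δ²fΔ²gΔ²h]`, and the POINTWISE inequality `S_A+S_B+S_C ≥ 2Δ²fΔ²gΔ²h` on chains.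

This part: `clone_cov` (`Σ_{x,x'} w w'(u x − u x')(v x − v x') = 2Cov`), `esum_S_pattern` (`E[S] = 8P` for the pattern "two functions share one chain"),
`pointwise_oriented` (three monotone nonnegative 2×2 tables: `S_A + S_B + S_C ≥ 2·δ_fδ_gδ_h`; in each sign pattern two single summands dominate).
-/

noncomputable section

open scoped Classical

namespace Summit.CriticalPhenomena.PercolationContinuityZ3.Theorems

namespace SahiChainTriangle

open Finset
open Literature.Combinatorics.Sahi2008

/-! ### Generic clone lemmas on one finite probability space -/

section Clone

variable {X : Type} [Fintype X] (w : X → ℝ)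

/-- Mixed-difference clone formula for a kernel: `Σ_{x,x'} w w' (J x x − J x x' − J x' x + J x' x') = 2 Σ_x w J x x − 2 Σ_{x,x'} w w' J x x'`. [folklore] -/
theorem clone_kernel (hw : ∑ x, w x = 1) (J : X → X → ℝ) :
    (∑ x, ∑ x', w x * w x' * (J x x - J x x' - J x' x + J x' x')) =
      2 * (∑ x, w x * J x x) - 2 * ∑ x, ∑ x', w x * w x' * J x x' := by
  have h1 : (∑ x, ∑ x', w x * w x' * J x x) = ∑ x, w x * J x x := by
    refine sum_congr rfl fun x _ => ?_
    rw [show (∑ x', w x * w x' * J x x) = (∑ x', w x') * (w x * J x x) by rw [sum_mul]; exact sum_congr rfl fun _ _ => by ring,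
      hw, one_mul]
  have h2 : (∑ x, ∑ x', w x * w x' * J x' x') = ∑ x, w x * J x x := by
    rw [sum_comm]
    refine sum_congr rfl fun x' _ => ?_
    rw [show (∑ x, w x * w x' * J x' x') = (∑ x, w x) * (w x' * J x' x') by rw [sum_mul]; exact sum_congr rfl fun _ _ => by ring,
      hw, one_mul]
  have h3 : (∑ x, ∑ x', w x * w x' * J x' x) = ∑ x, ∑ x', w x * w x' * J x x' := by
    rw [sum_comm]; exact sum_congr rfl fun _ _ => sum_congr rfl fun _ _ => by ring
  have hsplit : (∑ x, ∑ x', w x * w x' * (J x x - J x x' - J x' x + J x' x')) =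
      (∑ x, ∑ x', w x * w x' * J x x) - (∑ x, ∑ x', w x * w x' * J x x') - (∑ x, ∑ x', w x * w x' * J x' x)
        + ∑ x, ∑ x', w x * w x' * J x' x' := by
    simp only [← sum_sub_distrib, ← sum_add_distrib]
    exact sum_congr rfl fun _ _ => sum_congr rfl fun _ _ => by ring
  rw [hsplit, h1, h2, h3]; ring

/-- **Clone formula for a covariance**: `Σ_{x,x'} w w' (u x − u x')(v x − v x') = 2 Σ w u v − 2 (Σ w u)(Σ w v)`. [folklore] -/
theorem clone_cov (hw : ∑ x, w x = 1) (u v : X → ℝ) :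
    (∑ x, ∑ x', w x * w x' * ((u x - u x') * (v x - v x'))) =
      2 * (∑ x, w x * (u x * v x)) - 2 * ((∑ x, w x * u x) * ∑ x, w x * v x) := by
  have h := clone_kernel w hw (fun x x' => u x * v x')
  have hl : (∑ x, ∑ x', w x * w x' * ((u x - u x') * (v x - v x'))) =
      ∑ x, ∑ x', w x * w x' * (u x * v x - u x * v x' - u x' * v x + u x' * v x') :=
    sum_congr rfl fun _ _ => sum_congr rfl fun _ _ => by ring
  have hr : (∑ x, ∑ x', w x * w x' * (u x * v x')) = (∑ x, w x * u x) * ∑ x, w x * v x := by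
    rw [sum_mul]; refine sum_congr rfl fun x _ => ?_
    rw [mul_sum]; exact sum_congr rfl fun _ _ => by ring
  rw [hl, h, hr]

/-- Averaging over which clone is used: `Σ_{x,x'} w w' (φ x + φ x') = 2 Σ w φ`. [folklore] -/
theorem clone_avg (hw : ∑ x, w x = 1) (φ : X → ℝ) :
    (∑ x, ∑ x', w x * w x' * (φ x + φ x')) = 2 * ∑ x, w x * φ x := by
  have h1 : (∑ x, ∑ x', w x * w x' * φ x) = ∑ x, w x * φ x := by
    refine sum_congr rfl fun x _ => ?_
    rw [show (∑ x', w x * w x' * φ x) = (∑ x', w x') * (w x * φ x) by rw [sum_mul]; exact sum_congr rfl fun _ _ => by ring, hw, one_mul]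
  have h2 : (∑ x, ∑ x', w x * w x' * φ x') = ∑ x, w x * φ x := by
    rw [sum_comm]; refine sum_congr rfl fun x' _ => ?_
    rw [show (∑ x, w x * w x' * φ x') = (∑ x, w x) * (w x' * φ x') by rw [sum_mul]; exact sum_congr rfl fun _ _ => by ring, hw, one_mul]
  have : (∑ x, ∑ x', w x * w x' * (φ x + φ x')) = (∑ x, ∑ x', w x * w x' * φ x) + ∑ x, ∑ x', w x * w x' * φ x' := by
    simp only [← sum_add_distrib]; exact sum_congr rfl fun _ _ => sum_congr rfl fun _ _ => by ring
  rw [this, h1, h2]; ring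

/-- Pulling a constant out of a double clone sum. [folklore] -/
theorem clone_factor (r : ℝ) (P : X → X → ℝ) :
    (∑ x, ∑ x', w x * w x' * (r * P x x')) = r * ∑ x, ∑ x', w x * w x' * P x x' := by
  rw [mul_sum]; refine sum_congr rfl fun x _ => ?_
  rw [mul_sum]; exact sum_congr rfl fun x' _ => by ring

end Clone

/-! ### The `S`-pattern: two functions sharing the chain `X`, tested against the third -/

section Pattern

variable {X Y Z : Type} [Fintype X] [Fintype Y] [Fintype Z] (wX : X → ℝ) (wY : Y → ℝ) (wZ : Z → ℝ)

/-- **`8·P = E[S]`** for the pattern "`u(x,·)` and `v(x,·)` share the chain `x`, `t` is `x`-free":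
`Σ_{y,y'} w w' Σ_{z,z'} w w' Σ_{x,x'} w w' Σ_{y°∈{y,y'},z°∈{z,z'}} t(y°,z°)(u x y° − u x' y°)(v x z° − v x' z°) = 8 Σ_{y,z} wY wZ t(y,z)·Cov_x(u(·,y), v(·,z))`.
[this work] -/
theorem esum_S_pattern (hX : ∑ x, wX x = 1) (hY : ∑ y, wY y = 1) (hZ : ∑ z, wZ z = 1)
    (u : X → Y → ℝ) (v : X → Z → ℝ) (t : Y → Z → ℝ) :
    (∑ y, ∑ y', wY y * wY y' * ∑ z, ∑ z', wZ z * wZ z' * ∑ x, ∑ x', wX x * wX x' *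
      (t y z * ((u x y - u x' y) * (v x z - v x' z)) + t y z' * ((u x y - u x' y) * (v x z' - v x' z'))
        + t y' z * ((u x y' - u x' y') * (v x z - v x' z)) + t y' z' * ((u x y' - u x' y') * (v x z' - v x' z')))) =
      8 * ∑ y, ∑ z, wY y * wZ z * (t y z * ((∑ x, wX x * (u x y * v x z)) - (∑ x, wX x * u x y) * ∑ x, wX x * v x z)) := by
  -- step 1: the inner (x,x') sums give t(y°,z°)·K(y°,z°), K = 2 Cov_x
  have step1 : ∀ y y' z z', (∑ x, ∑ x', wX x * wX x' *
      (t y z * ((u x y - u x' y) * (v x z - v x' z)) + t y z' * ((u x y - u x' y) * (v x z' - v x' z'))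
        + t y' z * ((u x y' - u x' y') * (v x z - v x' z)) + t y' z' * ((u x y' - u x' y') * (v x z' - v x' z')))) =
      t y z * (2 * (∑ x, wX x * (u x y * v x z)) - 2 * ((∑ x, wX x * u x y) * ∑ x, wX x * v x z))
      + t y z' * (2 * (∑ x, wX x * (u x y * v x z')) - 2 * ((∑ x, wX x * u x y) * ∑ x, wX x * v x z'))
      + t y' z * (2 * (∑ x, wX x * (u x y' * v x z)) - 2 * ((∑ x, wX x * u x y') * ∑ x, wX x * v x z))
      + t y' z' * (2 * (∑ x, wX x * (u x y' * v x z')) - 2 * ((∑ x, wX x * u x y') * ∑ x, wX x * v x z')) := by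
    intro y y' z z'
    have e := fun (yy : Y) (zz : Z) => clone_cov wX hX (fun x => u x yy) (fun x => v x zz)
    have hsplit : (∑ x, ∑ x', wX x * wX x' *
        (t y z * ((u x y - u x' y) * (v x z - v x' z)) + t y z' * ((u x y - u x' y) * (v x z' - v x' z'))
          + t y' z * ((u x y' - u x' y') * (v x z - v x' z)) + t y' z' * ((u x y' - u x' y') * (v x z' - v x' z')))) =
        (∑ x, ∑ x', wX x * wX x' * (t y z * ((u x y - u x' y) * (v x z - v x' z))))
        + (∑ x, ∑ x', wX x * wX x' * (t y z' * ((u x y - u x' y) * (v x z' - v x' z'))))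
        + (∑ x, ∑ x', wX x * wX x' * (t y' z * ((u x y' - u x' y') * (v x z - v x' z))))
        + ∑ x, ∑ x', wX x * wX x' * (t y' z' * ((u x y' - u x' y') * (v x z' - v x' z'))) := by
      simp only [← sum_add_distrib]
      exact sum_congr rfl fun _ _ => sum_congr rfl fun _ _ => by ring
    rw [hsplit, clone_factor, clone_factor, clone_factor, clone_factor, e y z, e y z', e y' z, e y' z']
  simp_rw [step1]
  -- step 2: the (z,z') sums, pattern Σ_{z,z'} w w' (φ z + φ z')
  have step2 : ∀ y y', (∑ z, ∑ z', wZ z * wZ z' *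
      (t y z * (2 * (∑ x, wX x * (u x y * v x z)) - 2 * ((∑ x, wX x * u x y) * ∑ x, wX x * v x z))
      + t y z' * (2 * (∑ x, wX x * (u x y * v x z')) - 2 * ((∑ x, wX x * u x y) * ∑ x, wX x * v x z'))
      + t y' z * (2 * (∑ x, wX x * (u x y' * v x z)) - 2 * ((∑ x, wX x * u x y') * ∑ x, wX x * v x z))
      + t y' z' * (2 * (∑ x, wX x * (u x y' * v x z')) - 2 * ((∑ x, wX x * u x y') * ∑ x, wX x * v x z')))) =
      2 * (∑ z, wZ z * (t y z * (2 * (∑ x, wX x * (u x y * v x z)) - 2 * ((∑ x, wX x * u x y) * ∑ x, wX x * v x z))))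
      + 2 * ∑ z, wZ z * (t y' z * (2 * (∑ x, wX x * (u x y' * v x z)) - 2 * ((∑ x, wX x * u x y') * ∑ x, wX x * v x z))) := by
    intro y y'
    have e1 := clone_avg wZ hZ (fun z => t y z * (2 * (∑ x, wX x * (u x y * v x z)) - 2 * ((∑ x, wX x * u x y) * ∑ x, wX x * v x z)))
    have e2 := clone_avg wZ hZ (fun z => t y' z * (2 * (∑ x, wX x * (u x y' * v x z)) - 2 * ((∑ x, wX x * u x y') * ∑ x, wX x * v x z)))
    rw [← e1, ← e2, ← sum_add_distrib]
    refine sum_congr rfl fun z _ => ?_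
    rw [← sum_add_distrib]
    exact sum_congr rfl fun z' _ => by ring
  simp_rw [step2]
  -- step 3: the (y,y') sums
  have e3 := clone_avg wY hY (fun y => 2 * ∑ z, wZ z * (t y z * (2 * (∑ x, wX x * (u x y * v x z)) - 2 * ((∑ x, wX x * u x y) * ∑ x, wX x * v x z))))
  rw [e3]
  conv_lhs => rw [mul_sum]
  conv_rhs => rw [mul_sum]
  refine sum_congr rfl fun y _ => ?_
  conv_lhs => rw [mul_left_comm, mul_sum, mul_sum, mul_sum]
  conv_rhs => rw [mul_sum]
  exact sum_congr rfl fun z _ => by ring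

end Pattern

/-! ### The pointwise inequality on 2×2 monotone tables -/

section Pointwise

/-- **POINTWISE INEQUALITY (oriented clones).**  For three monotone nonnegative `2×2` tables `f_{c a}, g_{c b}, h_{a b}` (indices `0 ≤ 1` = smaller/larger clone):
`S_A + S_B + S_C ≥ 2·δ_f δ_g δ_h` with `δ = mixed second difference`. [this work] -/
theorem pointwise_oriented
    (f00 f01 f10 f11 g00 g01 g10 g11 h00 h01 h10 h11 : ℝ)
    (hf0 : 0 ≤ f00) (hf1 : f00 ≤ f01) (hf2 : f00 ≤ f10) (hf3 : f01 ≤ f11) (hf4 : f10 ≤ f11)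
    (hg0 : 0 ≤ g00) (hg1 : g00 ≤ g01) (hg2 : g00 ≤ g10) (hg3 : g01 ≤ g11) (hg4 : g10 ≤ g11)
    (hh0 : 0 ≤ h00) (hh1 : h00 ≤ h01) (hh2 : h00 ≤ h10) (hh3 : h01 ≤ h11) (hh4 : h10 ≤ h11) :
    2 * ((f11 - f01 - f10 + f00) * (g11 - g01 - g10 + g00) * (h11 - h01 - h10 + h00)) ≤
      -- S_C : h(a°,b°) (f(c,a°) − f(c',a°)) (g(c,b°) − g(c',b°))   [f_{c a}: first index c, second a; g_{c b}; h_{a b}]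
      (h11 * ((f11 - f01) * (g11 - g01)) + h10 * ((f11 - f01) * (g10 - g00))
        + h01 * ((f10 - f00) * (g11 - g01)) + h00 * ((f10 - f00) * (g10 - g00)))
      -- S_A : g(c°,b°) (f(c°,a) − f(c°,a')) (h(a,b°) − h(a',b°))
      + (g11 * ((f11 - f10) * (h11 - h01)) + g10 * ((f11 - f10) * (h10 - h00))
        + g01 * ((f01 - f00) * (h11 - h01)) + g00 * ((f01 - f00) * (h10 - h00)))
      -- S_B : f(c°,a°) (g(c°,b) − g(c°,b')) (h(a°,b) − h(a°,b'))
      + (f11 * ((g11 - g10) * (h11 - h10)) + f10 * ((g11 - g10) * (h01 - h00))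
        + f01 * ((g01 - g00) * (h11 - h10)) + f00 * ((g01 - g00) * (h01 - h00))) := by
  -- all twelve summands are nonnegative
  have x1 : 0 ≤ f11 - f01 := by linarith
  have x0 : 0 ≤ f10 - f00 := by linarith
  have u1 : 0 ≤ f11 - f10 := by linarith
  have u0 : 0 ≤ f01 - f00 := by linarith
  have y1 : 0 ≤ g11 - g01 := by linarith
  have y0 : 0 ≤ g10 - g00 := by linarith
  have v1 : 0 ≤ g11 - g10 := by linarith
  have v0 : 0 ≤ g01 - g00 := by linarith
  have z1 : 0 ≤ h11 - h01 := by linarith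
  have z0 : 0 ≤ h10 - h00 := by linarith
  have q1 : 0 ≤ h11 - h10 := by linarith
  have q0 : 0 ≤ h01 - h00 := by linarith
  have hf01 : 0 ≤ f01 := by linarith
  have hf10 : 0 ≤ f10 := by linarith
  have hf11 : 0 ≤ f11 := by linarith
  have hg01 : 0 ≤ g01 := by linarith
  have hg10 : 0 ≤ g10 := by linarith
  have hg11 : 0 ≤ g11 := by linarith
  have hh01 : 0 ≤ h01 := by linarith
  have hh10 : 0 ≤ h10 := by linarith
  have hh11 : 0 ≤ h11 := by linarith
  have sC1 := mul_nonneg hh11 (mul_nonneg x1 y1)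
  have sC2 := mul_nonneg hh10 (mul_nonneg x1 y0)
  have sC3 := mul_nonneg hh01 (mul_nonneg x0 y1)
  have sC4 := mul_nonneg hh0 (mul_nonneg x0 y0)
  have sA1 := mul_nonneg hg11 (mul_nonneg u1 z1)
  have sA2 := mul_nonneg hg10 (mul_nonneg u1 z0)
  have sA3 := mul_nonneg hg01 (mul_nonneg u0 z1)
  have sA4 := mul_nonneg hg0 (mul_nonneg u0 z0)
  have sB1 := mul_nonneg hf11 (mul_nonneg v1 q1)
  have sB2 := mul_nonneg hf10 (mul_nonneg v1 q0)
  have sB3 := mul_nonneg hf01 (mul_nonneg v0 q1)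
  have sB4 := mul_nonneg hf0 (mul_nonneg v0 q0)
  set df := f11 - f01 - f10 + f00 with hdf
  set dg := g11 - g01 - g10 + g00 with hdg
  set dh := h11 - h01 - h10 + h00 with hdh
  -- sign cases
  rcases le_or_gt 0 df with hF | hF <;> rcases le_or_gt 0 dg with hG | hG <;> rcases le_or_gt 0 dh with hH | hH
  · -- all ≥ 0: h11 x1 y1 ≥ δδδ and g11 u1 z1 ≥ δδδ
    have a1 : df ≤ f11 - f01 := by linarith
    have a2 : dg ≤ g11 - g01 := by linarith
    have a3 : dh ≤ h11 := by linarith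
    have b1 : df ≤ f11 - f10 := by linarith
    have b2 : dh ≤ h11 - h01 := by linarith
    have b3 : dg ≤ g11 := by linarith
    have t1 : df * dg * dh ≤ h11 * ((f11 - f01) * (g11 - g01)) := by
      calc df * dg * dh ≤ (f11 - f01) * (g11 - g01) * h11 := by gcongr
        _ = h11 * ((f11 - f01) * (g11 - g01)) := by ring
    have t2 : df * dg * dh ≤ g11 * ((f11 - f10) * (h11 - h01)) := by
      calc df * dg * dh = df * dh * dg := by ring
        _ ≤ (f11 - f10) * (h11 - h01) * g11 := by gcongr
        _ = g11 * ((f11 - f10) * (h11 - h01)) := by ring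
    linarith [sC1, sC2, sC3, sC4, sA1, sA2, sA3, sA4, sB1, sB2, sB3, sB4]
  · -- δ_h < 0 ≤ δ_f, δ_g: product ≤ 0
    have : df * dg * dh ≤ 0 := mul_nonpos_iff.2 (Or.inl ⟨mul_nonneg hF hG, hH.le⟩)
    linarith [sC1, sC2, sC3, sC4, sA1, sA2, sA3, sA4, sB1, sB2, sB3, sB4]
  · -- δ_g < 0 ≤ δ_f, 0 ≤ δ_h : product ≤ 0
    have : df * dg * dh ≤ 0 := by
      have : df * dg ≤ 0 := mul_nonpos_iff.2 (Or.inl ⟨hF, hG.le⟩)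
      exact mul_nonpos_iff.2 (Or.inr ⟨this, hH⟩)
    linarith [sC1, sC2, sC3, sC4, sA1, sA2, sA3, sA4, sB1, sB2, sB3, sB4]
  · -- δ_g, δ_h < 0 ≤ δ_f : h(a,b') = h10 · x1 · y0  and  g(c,b') = g10 · u1 · z0
    have a1 : df ≤ f11 - f01 := by linarith
    have a2 : -dg ≤ g10 - g00 := by linarith
    have a3 : -dh ≤ h10 := by linarith
    have b1 : df ≤ f11 - f10 := by linarith
    have b2 : -dh ≤ h10 - h00 := by linarith
    have b3 : -dg ≤ g10 := by linarith
    have nG : 0 ≤ -dg := by linarith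
    have nH : 0 ≤ -dh := by linarith
    have t1 : df * (-dg) * (-dh) ≤ h10 * ((f11 - f01) * (g10 - g00)) := by
      calc df * (-dg) * (-dh) ≤ (f11 - f01) * (g10 - g00) * h10 := by gcongr
        _ = h10 * ((f11 - f01) * (g10 - g00)) := by ring
    have t2 : df * (-dg) * (-dh) ≤ g10 * ((f11 - f10) * (h10 - h00)) := by
      calc df * (-dg) * (-dh) = df * (-dh) * (-dg) := by ring
        _ ≤ (f11 - f10) * (h10 - h00) * g10 := by gcongr
        _ = g10 * ((f11 - f10) * (h10 - h00)) := by ring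
    linarith [sC1, sC2, sC3, sC4, sA1, sA2, sA3, sA4, sB1, sB2, sB3, sB4]
  · -- δ_f < 0 ≤ δ_g, δ_h: product ≤ 0
    have : df * dg * dh ≤ 0 := by
      have : df * dg ≤ 0 := mul_nonpos_iff.2 (Or.inr ⟨hF.le, hG⟩)
      exact mul_nonpos_iff.2 (Or.inr ⟨this, hH⟩)
    linarith [sC1, sC2, sC3, sC4, sA1, sA2, sA3, sA4, sB1, sB2, sB3, sB4]
  · -- δ_f, δ_h < 0 ≤ δ_g : h(a',b) = h01 · x0 · y1  and  f(c,a') = f10 · v1 · q0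
    have a1 : -df ≤ f10 - f00 := by linarith
    have a2 : dg ≤ g11 - g01 := by linarith
    have a3 : -dh ≤ h01 := by linarith
    have b1 : dg ≤ g11 - g10 := by linarith
    have b2 : -dh ≤ h01 - h00 := by linarith
    have b3 : -df ≤ f10 := by linarith
    have nF : 0 ≤ -df := by linarith
    have nH : 0 ≤ -dh := by linarith
    have t1 : (-df) * dg * (-dh) ≤ h01 * ((f10 - f00) * (g11 - g01)) := by
      calc (-df) * dg * (-dh) ≤ (f10 - f00) * (g11 - g01) * h01 := by gcongr
        _ = h01 * ((f10 - f00) * (g11 - g01)) := by ring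
    have t2 : (-df) * dg * (-dh) ≤ f10 * ((g11 - g10) * (h01 - h00)) := by
      calc (-df) * dg * (-dh) = dg * (-dh) * (-df) := by ring
        _ ≤ (g11 - g10) * (h01 - h00) * f10 := by gcongr
        _ = f10 * ((g11 - g10) * (h01 - h00)) := by ring
    linarith [sC1, sC2, sC3, sC4, sA1, sA2, sA3, sA4, sB1, sB2, sB3, sB4]
  · -- δ_f, δ_g < 0 ≤ δ_h : g(c',b) = g01 · u0 · z1  and  f(c',a) = f01 · v0 · q1
    have a1 : -df ≤ f01 - f00 := by linarith
    have a2 : dh ≤ h11 - h01 := by linarith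
    have a3 : -dg ≤ g01 := by linarith
    have b1 : -dg ≤ g01 - g00 := by linarith
    have b2 : dh ≤ h11 - h10 := by linarith
    have b3 : -df ≤ f01 := by linarith
    have nF : 0 ≤ -df := by linarith
    have nG : 0 ≤ -dg := by linarith
    have t1 : (-df) * (-dg) * dh ≤ g01 * ((f01 - f00) * (h11 - h01)) := by
      calc (-df) * (-dg) * dh = (-df) * dh * (-dg) := by ring
        _ ≤ (f01 - f00) * (h11 - h01) * g01 := by gcongr
        _ = g01 * ((f01 - f00) * (h11 - h01)) := by ring
    have t2 : (-df) * (-dg) * dh ≤ f01 * ((g01 - g00) * (h11 - h10)) := by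
      calc (-df) * (-dg) * dh = (-dg) * dh * (-df) := by ring
        _ ≤ (g01 - g00) * (h11 - h10) * f01 := by gcongr
        _ = f01 * ((g01 - g00) * (h11 - h10)) := by ring
    linarith [sC1, sC2, sC3, sC4, sA1, sA2, sA3, sA4, sB1, sB2, sB3, sB4]
  · -- all three < 0: product ≤ 0
    have : df * dg * dh ≤ 0 := by
      have : 0 ≤ df * dg := (mul_pos_of_neg_of_neg hF hG).le
      exact mul_nonpos_iff.2 (Or.inl ⟨this, hH.le⟩)
    linarith [sC1, sC2, sC3, sC4, sA1, sA2, sA3, sA4, sB1, sB2, sB3, sB4]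

end Pointwise

end SahiChainTriangle

end Summit.CriticalPhenomena.PercolationContinuityZ3.Theorems
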